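import Mathlib.MeasureTheory.Measure.Lebesgue.VolumeOfBalls
import Summits.AtomisticToContinuum.HydrodynamicLimit.Theorems.SpecularDiceHopf.Negative.HopfPropertyTeeth

/-!
# Negative lane of crux `SpecularDiceHopf`: the static hypotheses do not give (H)

Route `AnosovDiceHopf`, crux `SpecularDiceHopf` (stmt-AtomisticToContinuum-13414). Refuter
load-bearing analysis (`--supports`; no route statement is asserted). The crux (informal; candidate
signature in the item evidence `W.lean`) concludes the one-sphere Hopf property (H) of a law `μ` under an
infinite hard-sphere flow `Φ` from FOUR hypotheses: `μ` is an OVY limit state, `μ` is a regular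
stationary state of `Φ`, `μ {∅} = 0` (no vacuum atom) and componentwise diluteness at some threshold
`η₀ > 0`. Here: the counter-model `(Φ₀, δ_{ω₀})` of `HopfPropertyTeeth` (two spheres colliding
head-on) satisfies the two STATIC hypotheses — no vacuum atom (`dirac_ω₀_empty`) and diluteness at
EVERY threshold `η₀ > 0` (`dirac_ω₀_dilute`: two points against cubes of volume `→ ∞`) — and is a
probability law, yet violates (H). Hence `specularDiceHopf_false_without_dynamics`: the crux with its
two DYNAMICAL hypotheses (OVY limit, regular stationarity) dropped is false for every threshold (stated
inline, no new `def`); any proof of the crux must use them.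
-/

noncomputable section

open MeasureTheory ProbabilityTheory Set Filter Function Metric
open scoped ENNReal Topology
open Literature.Analysis.FunctionSpaces Literature.Analysis.FluidPDE
open Literature.MathematicalPhysics.KineticTheory

namespace Summit.AtomisticToContinuum.HydrodynamicLimit.Theorems.SpecularDiceHopf.Negative

local notation "E³" => EuclideanSpace ℝ (Fin 3)

/-- `δ_{ω₀}` has no vacuum atom: `δ_{ω₀} {∅} = 0` (the empty configuration counts no point at `p₀`,
`ω₀` counts one). -/
theorem dirac_ω₀_empty : Measure.dirac ω₀ ({∅} : Set (PointConfig (E³ × E³))) = 0 := by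
  have hT : MeasurableSet {ω : PointConfig (E³ × E³) | ω.count {p₀} = 0} :=
    PointConfig.measurable_count (measurableSet_singleton p₀) (measurableSet_singleton 0)
  refine measure_mono_null (t := {ω : PointConfig (E³ × E³) | ω.count {p₀} = 0})
    (fun ω hω => ?_) ?_
  · show ω.count {p₀} = 0
    rw [mem_singleton_iff] at hω
    subst hω
    exact PointConfig.count_empty _
  · rw [Measure.dirac_apply' _ hT, indicator_of_notMem]
    show ¬ ω₀.count {p₀} = 0
    rw [count_ω₀_p₀]
    exact one_ne_zero

/-- `ω₀` has at most two points in any set. -/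
theorem count_ω₀_le_two (s : Set (E³ × E³)) : ω₀.count s ≤ 2 := by
  rw [count_eq, coe_ω₀]
  calc (S₀ ∩ s).encard ≤ S₀.encard := encard_le_encard inter_subset_left
    _ = 2 := by rw [S₀, encard_pair p₀_ne_q₀]

/-- `δ_{ω₀}`-almost every configuration is `ω₀`. -/
theorem ae_dirac_eq_ω₀ : ∀ᵐ ω ∂(Measure.dirac ω₀), ω = ω₀ := by
  rw [ae_iff]
  show Measure.dirac ω₀ ({ω₀}ᶜ : Set (PointConfig (E³ × E³))) = 0
  rw [Measure.dirac_apply' _ measurableSet_ω₀.compl,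
    indicator_of_notMem (notMem_compl_iff.2 (mem_singleton ω₀))]

/-- The ball of radius `n + 1` lies in the centred cube `Λ_n = [-(n+1), n+1)³`. -/
theorem ball_subset_centredBox (n : ℕ) :
    Metric.ball (0 : E³) ((n : ℝ) + 1) ⊆ PointProcess.centredBox (d := Fin 3) n := by
  intro x hx i
  rw [mem_ball_zero_iff] at hx
  have h1 : |x i| ≤ ‖x‖ := by
    have := PiLp.norm_apply_le x i
    rwa [Real.norm_eq_abs] at this
  have h2 := abs_lt.1 (h1.trans_lt hx)
  exact ⟨h2.1.le, h2.2⟩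

/-- The volumes of the centred cubes, multiplied by any `η₀ > 0`, tend to `∞`. -/
theorem tendsto_mul_volume_centredBox (η₀ : ℝ≥0∞) (hη₀ : 0 < η₀) :
    Tendsto (fun n : ℕ => η₀ * volume (PointProcess.centredBox (d := Fin 3) n)) atTop (𝓝 ⊤) := by
  set C : ℝ≥0∞ := ENNReal.ofReal (√Real.pi ^ Fintype.card (Fin 3) /
    Real.Gamma (Fintype.card (Fin 3) / 2 + 1)) with hC
  have hCpos : 0 < C := by
    rw [hC, ENNReal.ofReal_pos]
    exact div_pos (pow_pos (Real.sqrt_pos.2 Real.pi_pos) _) (Real.Gamma_pos_of_pos (by positivity))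
  -- lower bound `η₀ * C * (n + 1)` tends to `∞`
  have hm : Tendsto (fun n : ℕ => ENNReal.ofReal ((n : ℝ) + 1)) atTop (𝓝 ⊤) :=
    ENNReal.tendsto_ofReal_atTop.comp
      (tendsto_atTop_add_const_right atTop 1 tendsto_natCast_atTop_atTop)
  have hf : Tendsto (fun n : ℕ => (η₀ * C) * ENNReal.ofReal ((n : ℝ) + 1)) atTop (𝓝 ⊤) := by
    have h := ENNReal.Tendsto.const_mul (a := η₀ * C) hm (Or.inl ENNReal.top_ne_zero)
    rwa [ENNReal.mul_top (mul_ne_zero hη₀.ne' hCpos.ne')] at h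
  refine tendsto_nhds_top_mono' hf fun n => ?_
  -- `η₀ * C * (n+1) ≤ η₀ * vol (Λ_n)` from `ball 0 (n+1) ⊆ Λ_n`
  have hr : (1 : ℝ≥0∞) ≤ ENNReal.ofReal ((n : ℝ) + 1) := by
    rw [← ENNReal.ofReal_one]
    exact ENNReal.ofReal_le_ofReal (by linarith [n.cast_nonneg (α := ℝ)])
  have hball : ENNReal.ofReal ((n : ℝ) + 1) ^ Fintype.card (Fin 3) * C ≤
      volume (PointProcess.centredBox (d := Fin 3) n) := by
    rw [hC, ← EuclideanSpace.volume_ball (Fin 3) (0 : E³) ((n : ℝ) + 1)]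
    exact measure_mono (ball_subset_centredBox n)
  calc (η₀ * C) * ENNReal.ofReal ((n : ℝ) + 1)
      = η₀ * (ENNReal.ofReal ((n : ℝ) + 1) * C) := by ring
    _ ≤ η₀ * (ENNReal.ofReal ((n : ℝ) + 1) ^ Fintype.card (Fin 3) * C) := by
        gcongr
        exact le_self_pow₀ hr (by simp)
    _ ≤ η₀ * volume (PointProcess.centredBox (d := Fin 3) n) := by
        gcongr

/-- `δ_{ω₀}` is componentwise dilute at EVERY threshold `η₀ > 0` (two points against cubes whose
volume tends to infinity), in the exact shape of the crux's diluteness clause. -/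
theorem dirac_ω₀_dilute (η₀ : ℝ≥0∞) (hη₀ : 0 < η₀) :
    ∀ᵐ ω ∂(Measure.dirac ω₀), ∀ᶠ n : ℕ in atTop,
      ((PointConfig.count ω (PointProcess.centredBox n ×ˢ (Set.univ : Set E³))) : ℝ≥0∞) ≤
        η₀ * volume (PointProcess.centredBox (d := Fin 3) n) := by
  filter_upwards [ae_dirac_eq_ω₀] with ω hω
  subst hω
  have hev : ∀ᶠ n : ℕ in atTop, ((2 : ℕ) : ℝ≥0∞) < η₀ * volume (PointProcess.centredBox (d := Fin 3) n) :=
    ENNReal.tendsto_nhds_top_iff_nat.1 (tendsto_mul_volume_centredBox η₀ hη₀) 2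
  filter_upwards [hev] with n hn
  refine le_trans ?_ hn.le
  have h2 := count_ω₀_le_two (PointProcess.centredBox (d := Fin 3) n ×ˢ (Set.univ : Set E³))
  calc ((ω₀.count (PointProcess.centredBox (d := Fin 3) n ×ˢ (Set.univ : Set E³)) : ℕ∞) : ℝ≥0∞)
      ≤ ((2 : ℕ∞) : ℝ≥0∞) := ENat.toENNReal_le.2 h2
    _ = ((2 : ℕ) : ℝ≥0∞) := by simp

/-- **Any proof of `SpecularDiceHopf` must use its dynamical hypotheses.** THE CRUX WITH ITS
DYNAMICAL HYPOTHESES DROPPED — the candidate signature of `SpecularDiceHopf` minus "`μ` is an OVY limit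
state" and "`μ` is a regular stationary state of `Φ`", keeping probability, no vacuum atom and
componentwise diluteness at a threshold `η₀ > 0` to be chosen — is FALSE, whatever the threshold:
witness the two-sphere head-on flow `Φ₀` and `δ_{ω₀}` (`not_hasOneSphereHopfProperty`). -/
theorem specularDiceHopf_false_without_dynamics :
    ¬ ∃ η₀ : ℝ≥0∞, 0 < η₀ ∧
      ∀ (Φ : InfiniteHardSphereFlow (Fin 3) 1) (μ : Measure (PointConfig (E³ × E³))),
        IsProbabilityMeasure μ → μ {∅} = 0 →
        (∀ᵐ ω ∂μ, ∀ᶠ n : ℕ in atTop,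
          ((PointConfig.count ω (PointProcess.centredBox n ×ˢ (Set.univ : Set E³))) : ℝ≥0∞) ≤
            η₀ * volume (PointProcess.centredBox (d := Fin 3) n)) →
        Φ.HasOneSphereHopfProperty μ := by
  rintro ⟨η₀, hη₀, h⟩
  exact not_hasOneSphereHopfProperty (h Φ₀ _ inferInstance dirac_ω₀_empty (dirac_ω₀_dilute η₀ hη₀))

end Summit.AtomisticToContinuum.HydrodynamicLimit.Theorems.SpecularDiceHopf.Negative
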